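import Summits.BirchSwinnertonDyer.BirchSwinnertonDyer.Theorems.CumulativeHeegnerLeopoldtRedSplitControlAtThreeShaTwoBHN
import HarnessLib

/-!
# K4 `RedSplitControlAtThree` — PT2 (`poitouTate_sha_tateDual K`, `K` totally complex) from the doors' degree-`≤ 1`
# package and the idèle-cohomology statement (B) alone (seat `bsd-line-chl-p2`, gen 7)

HONEST FRAMING (cell `bsd-wall`): BSD is NOT proved here and no case of Poitou–Tate duality is proved outright.  This file
plugs the theorem `map_evalPointHom_eq_zero_of_mem_shaTwo` ((A3), file `…ShaTwoBHN`: Brauer–Hasse–Noether over `K(M)`)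
into `HomDual.localGlobal_of_forall_evalPoint` (inf–res in degree 2 + Hilbert 90) to obtain hypothesis (A) of
`poitouTate_sha_tateDual_of_localGlobal` (file `…ShaTwoNativeAssembly`, §3) as a theorem (`tateDual_localGlobal`), and
records the net reduction `poitouTate_sha_tateDual_of_idele`: PT2 ⟸ {`SelmerComplement`, Tate-duality record for `C̄`,
idèle projections with (R3), bridge with (R4)} + (B).

## References
* J. S. Milne, *Arithmetic Duality Theorems* (2006), I Thm. 4.10 (a) and its proof (p. 58), I Lemma 4.13. [MilneADT2006]
* J. W. S. Cassels, A. Fröhlich (eds.), *Algebraic Number Theory* (1967), Ch. VII §9.6, §11.1. [CasselsFrohlichANT1967]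
-/

noncomputable section

open Function NumberField IsDedekindDomain CategoryTheory
open scoped NumberField ContRepresentation

-- `Summit.<P>.<Sub>` repeats `BirchSwinnertonDyer` by the tree's layout convention (D-0017)
set_option linter.dupNamespace false

namespace Summit.BirchSwinnertonDyer.BirchSwinnertonDyer.Theorems.PoitouTateShaTwoReadout

open Field
open Literature.NumberTheory.GaloisRepresentations Literature.NumberTheory.GaloisCohomology
open Literature.NumberTheory.GaloisRepresentations.DiscreteGaloisModule (TateDual tateDual units shaTwo unramifiedSubgroup
  localTatePairingZMod)


/-! ## §4 (A) for every finite `M`, and PT2 from the doors' package + (B) -/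

section Final

variable {K : Type} [Field K] [NumberField K]

open Literature.NumberTheory.GaloisRepresentations.HomDual (localGlobal_of_forall_evalPoint tateDualUnitsIso dualF homF
  postcompResHom unitsTransfer unitsToIdeleI IdeleProjection readout)
open Literature.NumberTheory.GaloisRepresentations.FreePresentation (presModule₁ presModule₂ presProj moduleFinite_presModule₁
  moduleFinite_presModule₂ presentationComplex presentationComplex_shortExact)
open Literature.NumberTheory.GaloisRepresentations.DGMBridge (toDGM)
open Literature.NumberTheory.GaloisRepresentations.IdeleClassBar (classBarD)
open Literature.Algebra.Homology Literature.Algebra.Homology.DiscreteRep Literature.Algebra.Homology.ExtPresentation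
open Literature.AnabelianGeometry.AbsoluteAnabelian.Prop121vii (zmodToQmodZ)
open Summit.BirchSwinnertonDyer.BirchSwinnertonDyer.Theorems.SchneiderFreeAdditiveX3.PoitouTateReduction

/-- **Hypothesis (A) of `poitouTate_sha_tateDual_of_localGlobal` holds** (`K` totally complex): for every finite
`n`-torsion `M` and `c ∈ Ш²(K, M^D)`, `H²(p^*)(H²(e) c) = 0 ∈ H²(K, Hom_ℤ(P, K̄ˣ))` — inf–res + Hilbert 90
(`localGlobal_of_forall_evalPoint`) and (A3) (`map_evalPointHom_eq_zero_of_mem_shaTwo`: Brauer–Hasse–Noether over `K(M)`).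
[cite: MilneADT2006, I Thm. 4.10 (proof, p. 58)][cite: NeukirchSchmidtWingberg2008, (8.1.17)] -/
theorem tateDual_localGlobal [IsTotallyComplex K] {M : Type} [AddCommGroup M] [TopologicalSpace M] [DiscreteTopology M]
    [Finite M] (ρ : DiscreteGaloisModule K M) (n : ℕ) (hM : ∀ m : M, n • m = 0) :
    haveI := moduleFinite_presModule₂ ρ
    ∀ c ∈ shaTwo (ρ.tateDual n),
      cohomologyMap (dualF (presModule₂ ρ) ρ (units K) (presProj ρ)) 2
        (cohomologyMap (tateDualUnitsIso K ρ n hM).hom 2 c) = 0 :=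
  localGlobal_of_forall_evalPoint ρ n hM fun c hc m => map_evalPointHom_eq_zero_of_mem_shaTwo ρ n hM c hc m

/-- **THE NAMED FACT `poitouTate_sha_tateDual K` for a TOTALLY COMPLEX `K` from the doors' degree-`≤ 1` package and the
idèle-cohomology statement (B) alone** (hypothesis (A) of `poitouTate_sha_tateDual_of_localGlobal` is the theorem
`tateDual_localGlobal`).  Displayed hypotheses: `SelmerComplement` of the canonical invariant maps, the Tate-duality record
`(inv, hT)` for `C̄` (landed separately), ONE family `π` of idèle projections with (R3), the bridge `nat` with (R4), and
(B): a class of `H¹(K, Hom_ℤ(N₁, K̄ˣ))` whose transfers to every completion vanish dies in `H¹(K, Hom_ℤ(N₁, J̄))`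
(Milne I Lemma 4.13 in degree 1 for the relation lattice `N₁`).  HONEST FRAMING: a reduction; no case of BSD and no case
of Poitou–Tate is proved outright. [cite: MilneADT2006, Ch. I, Thm. 4.10 (a) (proof, p. 58), Lemma 4.13]
[cite: CasselsFrohlichANT1967, Ch. VII §9.6, §11.1] -/
theorem poitouTate_sha_tateDual_of_idele [IsTotallyComplex K]
    (hcomp : ∀ (n : ℕ) [NeZero n], (LocalInvariants.canonical K n).SelmerComplement)
    (inv : Abelian.Ext (triv (Γ := absoluteGaloisGroup K) ℤ) (classBarD K) 2 →+ AddCircle (1 : ℚ))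
    (hT : TateDualityHypotheses (classBarD K) inv) (π : ∀ v : Place K, IdeleProjection K v)
    (hR3 : ∀ (n : ℕ) [NeZero n],
      ∀ ⦃M : Type⦄ [AddCommGroup M] [TopologicalSpace M] [DiscreteTopology M] [Finite M] [Finite (TateDual K M n)]
      (ρ₀ : DiscreteGaloisModule K M) (hM : ∀ m : M, n • m = 0),
      ∀ T : Finset (Place K), (∀ w : InfinitePlace K, (Sum.inl w : Place K) ∈ T) →
        (∀ v : HeightOneSpectrum (𝓞 K), (Sum.inr v : Place K) ∉ T →
          ((n : ℕ) : 𝓞 K) ∉ v.asIdeal ∧ GaloisRep.IsUnramifiedAt v (ρ₀.tateDual n)) →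
        ∀ t : Π v : Place K, galoisCohomology ((ρ₀.tateDual n).toLocal v) 1,
          (∀ v : HeightOneSpectrum (𝓞 K), (Sum.inr v : Place K) ∉ T →
            t (Sum.inr v) ∈ unramifiedSubgroup (GaloisRep.toLocal v (ρ₀.tateDual n)) 1) →
          ∃ f : (presentationComplex ρ₀).X₁ ⟶ (ideleClassLimitShortComplex K).X₂,
            ∀ v : Place K, readout ρ₀ n hM (π v) f = t v)
    (hR4 : ∀ (n : ℕ) [NeZero n],
      ∀ ⦃M : Type⦄ [AddCommGroup M] [TopologicalSpace M] [DiscreteTopology M] [Finite M] [Finite (TateDual K M n)]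
      (ρ₀ : DiscreteGaloisModule K M) (hM : ∀ m : M, n • m = 0),
      ∃ nat : galoisCohomology ((ρ₀.tateDual n).tateDual n) 1 →+
          Abelian.Ext (triv (Γ := absoluteGaloisGroup K) ℤ) (presentationComplex ρ₀).X₃ 1,
        Function.Bijective nat ∧
        ∀ f : (presentationComplex ρ₀).X₁ ⟶ (ideleClassLimitShortComplex K).X₂, ∃ Tf : Finset (Place K),
          ∀ (y : galoisCohomology ((ρ₀.tateDual n).tateDual n) 1) (T' : Finset (Place K)), Tf ⊆ T' →
            (∀ v : HeightOneSpectrum (𝓞 K), (Sum.inr v : Place K) ∉ T' →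
              galoisCohomology.localization ((ρ₀.tateDual n).tateDual n) (Sum.inr v) 1 y ∈
                unramifiedSubgroup (GaloisRep.toLocal v ((ρ₀.tateDual n).tateDual n)) 1) →
            zmodToQmodZ n (∑ v ∈ T', localTatePairingZMod (ρ₀.tateDual n) n v (LocalInvariants.canonical K n v)
              (readout ρ₀ n hM (π v) f)
              (galoisCohomology.localization ((ρ₀.tateDual n).tateDual n) v 1 y)) =
            inv ((nat y).comp (boundary (presentationComplex_shortExact ρ₀) (classBarD K)
              (f ≫ (ideleClassLimitShortComplex K).g)) (rfl : 1 + 1 = 2)))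
    (hB : ∀ (n : ℕ) [NeZero n],
      ∀ ⦃M : Type⦄ [AddCommGroup M] [TopologicalSpace M] [DiscreteTopology M] [Finite M]
      (ρ₀ : DiscreteGaloisModule K M),
        haveI := moduleFinite_presModule₁ ρ₀
        ∀ y : galoisCohomology (homGaloisModule (presModule₁ ρ₀) (units K)) 1,
          (∀ v : Place K, ContinuousCohomology.map (absGaloisRestrict K (Place.Completion v))
            (postcompResHom (presModule₁ ρ₀) (units K) (units (Place.Completion v)) (unitsTransfer K (Place.Completion v))) 1
              y = 0) →
          cohomologyMap (homF (presModule₁ ρ₀) (units K) (toDGM (ideleBarD K)) (unitsToIdeleI K)) 1 y = 0) :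
    poitouTate_sha_tateDual K :=
  poitouTate_sha_tateDual_of_localGlobal hcomp inv hT π hR3 hR4 (fun n _ _ _ _ _ _ ρ₀ hM => tateDual_localGlobal ρ₀ n hM) hB

end Final

end Summit.BirchSwinnertonDyer.BirchSwinnertonDyer.Theorems.PoitouTateShaTwoReadout

end
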